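import Mathlib
import Summits.PneNP.PneNP.Theses.OneSlice

/-!
# Route OneSlice — support item `TargetImpliesBand` (stmt-PneNP-2838)

`Summit.PneNP.PneNP.Theses.OneSlice.TargetImpliesBand : SliceTarget → ConstantBand`.

The single-slice target `SliceTarget` (every monotone circuit that errs on at most a
`δ`-fraction of the central slice `G(n,j)` for `k`-CLIQUE has more than `n^c` gates) implies the
constant-width band statement `ConstantBand` (same conclusion under the hypothesis
`Σ_{i = j-w}^{j+w} err_i / #slice_i ≤ δ` for some width `w`): take the same `k` and `δ` and the
width `w := 0`. Then `Finset.Icc (j - 0) (j + 0) = {j}`, the band sum is the single term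
`err_j / #slice_j ≤ δ`, and since `err_j ≤ #slice_j` (the error set is a sub-filter of the slice)
this gives `err_j ≤ δ · #slice_j` also in the degenerate case `#slice_j = 0` (where Lean's
`x / 0 = 0` makes the band hypothesis vacuous but `err_j = 0` anyway). This confirms that the
ladder of the route (`SliceTarget ⇒ ConstantBand ⇒ SingleThreshold`) is ordered at its top rung.

No literature is needed; pure logic plus `Finset.sum_singleton` and `div_le_iff₀`.
-/

namespace Summit.PneNP.PneNP.Theorems

open Summit.PneNP.PneNP.Theses.OneSlice

/-- Elementary real-arithmetic step: if `0 ≤ a ≤ b` and `a / b ≤ δ` then `a ≤ δ * b`, including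
the degenerate case `b = 0` (then `a = 0`). -/
theorem oneSlice_le_mul_of_div_le {a b δ : ℝ} (hab : a ≤ b) (ha : 0 ≤ a) (h : a / b ≤ δ) :
    a ≤ δ * b := by
  rcases eq_or_lt_of_le (ha.trans hab) with hb | hb
  · have ha0 : a = 0 := le_antisymm (hb ▸ hab) ha
    rw [ha0, ← hb, mul_zero]
  · rwa [div_le_iff₀ hb] at h

/-- **`TargetImpliesBand` (stmt-PneNP-2838).** The single-slice target implies the constant-band
statement: given `c`, take the `k ≥ 3` and `δ > 0` that `SliceTarget` provides for `c` and the
band width `w := 0`; for a central edge count `j` the band `Finset.Icc (j - 0) (j + 0)` is `{j}`,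
so the band hypothesis reads `err_j / #slice_j ≤ δ`, which gives `err_j ≤ δ · #slice_j` because
`err_j ≤ #slice_j`; `SliceTarget` then yields `n ^ c < C.size`. -/
theorem targetImpliesBand_proof : Summit.PneNP.PneNP.Theses.OneSlice.TargetImpliesBand := by
  unfold TargetImpliesBand
  intro hT c
  obtain ⟨k, hk, δ, hδ, hev⟩ := hT c
  refine ⟨k, hk, 0, δ, hδ, ?_⟩
  filter_upwards [hev] with n hn
  intro j hj C hC hsum
  refine hn j hj C hC ?_
  simp only [Nat.sub_zero, Nat.add_zero, Finset.Icc_self, Finset.sum_singleton] at hsum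
  refine oneSlice_le_mul_of_div_le ?_ (Nat.cast_nonneg _) hsum
  exact_mod_cast Finset.card_le_card (fun x hx => by
    simp only [Finset.mem_filter] at hx ⊢
    exact ⟨hx.1, hx.2.1⟩)

end Summit.PneNP.PneNP.Theorems
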